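import Mathlib
import HarnessLib
import Summits.HubbardSuperconductivity.HubbardSuperconductivity.Theorems.KLProgrammeKLRegimeEngineFlowPieceTablesGeometric
import Summits.HubbardSuperconductivity.HubbardSuperconductivity.Theorems.KLProgrammeKLRegimeEngineFlowPieceIncrementData

/-!
# K3 gen-8-FLOW (stmt 20437, stub (C), located risk «(C)-B-REP»/«(C)-B-ALIAS-L», sup route): the piece and frame-band jets of the flow at EVERY ORDER
# — `‖Dʲ evalM (klFlowPiece m)‖ ≤ A_j·4^{(j−2)m}` and `‖Dʲ e_{K_m}‖ ≤ 4^j + Σ_{m′<m} A_j·4^{(j−2)m′}` for all `j ≥ 1`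

Cell gate-hubbard-kl, seat p2 g13 (memo SUP-ROUTE-SPEC §2(c)/§4: the factor-jet lemmas `Literature.….HubbardUVSymbolDressingFactorJets` need the band jets
`‖Dⁱu‖ ≤ i!·E_uⁱ` (`u = e_{K_{m+1}}`) and the mismatch jets `‖Dⁱv‖ ≤ δ·i!·F_vⁱ` (`v = −klFlowPiece m`) at EVERY order `i ≤ M`, `M ≈ 20`, not only `i ≤ 4`/`≤ 6`).
`…EngineFlowPieceTablesGeometric.flowPiece_jets_geometric` capped the order at `6` only in its statement: its high-order branch IS the all-orders Jackson bound
`norm_iteratedFDeriv_evalM_jacksonFrame_klFrameExtFn_le_all` at the Jackson degree `klFlowDeg m ≤ 2⁸4^m − 1`.  Here the cap is removed: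

* **`flowPiece_jets_allOrders`** — for `m ≤ n` and EVERY `j`: `‖Dʲ evalM (klFlowPiece m)‖ ≤ A_j·4^{(j−2)m}`, `A_j` = the geometric table of p551806
  (`R.Gfr j·uPow j U` for `j ≤ 4`, `2^j(π⁸/4)2^{j−1}2^{8(j−1)}·(curveExtC X G.S 1 + curveExtC X Q.S' 1·|U|)U²` beyond);
* **`frameLevel_flowFrame_jets_allOrders`** — `‖Dʲ e_{K_m}‖ ≤ 4^j + Σ_{m′<m} A_j·4^{(j−2)m′}` for every `1 ≤ j` (`e_{K_m} = e_0 − evalM K_m`, `‖Dʲe_0‖ ≤ 4 ≤ 4^j`,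
  `norm_iteratedFDeriv_evalM_klFlowFrameU_le_sum`).

Proofs only; nothing about the model is asserted (the reading jets `TwoLegReadJetsF` and `(I-F jets)` are hypotheses, as in p551806).  References: BGM 2006 §2.3 (2.17),
(2.36) [cite: BenfattoGiulianiMastropietro2006]; Jackson–Bernstein (Zygmund X §3).
-/

noncomputable section

namespace Summit.HubbardSuperconductivity.HubbardSuperconductivity.Theorems.EngineV8

set_option linter.dupNamespace false -- summit = problem name (single-conjunct summit), D-0017

open Real Finset Literature.MathematicalPhysics.QuantumLattice Literature.Probability.LatticeModels
open Summit.HubbardSuperconductivity.HubbardSuperconductivity.Theorems.KLRegimeSplit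
open Summit.HubbardSuperconductivity.HubbardSuperconductivity.Theorems.DispersionFlow

variable {L M : ℕ} [NeZero L] [NeZero M]

/-- **THE GEOMETRIC PIECE TABLE OF THE FLOW AT EVERY ORDER.** -/
theorem flowPiece_jets_allOrders {G : GeoConsts} {Q : EngConsts} {R : RenConsts} (hGS : ∀ k, 0 ≤ G.S k) (hQS : ∀ k, 0 ≤ Q.S' k)
    {β U μ : ℝ} (hμ : μ ∈ klWindowC) {X : ℝ} (hX : ∀ l ≤ 4, ∀ x : ℝ, ‖iteratedFDeriv ℝ l salmhoferCutoff x‖ ≤ X)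
    {n : ℕ} (hP : ∀ m ≤ n, FlowPieceJetsAt L M β U μ R m) (hT : ∀ m ≤ n, TwoLegReadJetsF L M G Q β U μ m) :
    ∀ m ≤ n, ∀ j : ℕ, ∀ q : Momentum, ‖iteratedFDeriv ℝ j (evalM (klFlowPiece L M β U μ m)) q‖ ≤
      (if j ≤ 4 then R.Gfr j * uPow j U
        else 2 ^ j * (Real.pi ^ 8 / 4 * 2 ^ (j - 1) * (2 : ℝ) ^ (8 * (j - 1))) *
          ((curveExtC X G.S 1 + curveExtC X Q.S' 1 * |U|) * U ^ 2)) * (4 : ℝ) ^ (((j : ℤ) - 2) * m) := by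
  intro m hm j q
  by_cases hj4 : j ≤ 4
  · rw [if_pos hj4]
    exact hP m hm j hj4 q
  · rw [if_neg hj4]
    have hj1 : 1 ≤ j := by omega
    have hX0 : 0 ≤ X := (norm_nonneg _).trans (hX 0 (by norm_num) 0)
    obtain ⟨hν, hjet⟩ := hT m hm
    have hpiece : klFlowPiece L M β U μ m =
        jacksonFrame (klFlowDeg m) (klFrameExtFn μ (klLocalPart L M β U μ (klFlowFrameU L M β U μ m) m)) := rfl
    have h := norm_iteratedFDeriv_evalM_jacksonFrame_klFrameExtFn_le_all (L := L) (M := M) hGS hQS hμ hν hjet hX (klFlowDeg m) hj1 q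
    rw [hpiece]
    refine h.trans ?_
    have hcjb : curveJetBar (curveExtC X G.S) (curveExtC X Q.S') U 1 m =
        (curveExtC X G.S 1 + curveExtC X Q.S' 1 * |U|) * U ^ 2 * (4 : ℝ) ^ ((((1 : ℕ) : ℤ) - 2) * m) := by
      rw [curveJetBar_apply]
      simp [uPow]
    have hdeg : ((klFlowDeg m : ℕ) : ℝ) + 1 ≤ (2 : ℝ) ^ 8 * (4 : ℝ) ^ m := klFlowDeg_add_one_le m
    have hdegpow : (((klFlowDeg m : ℕ) : ℝ) + 1) ^ (j - 1) ≤ ((2 : ℝ) ^ 8 * (4 : ℝ) ^ m) ^ (j - 1) :=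
      pow_le_pow_left₀ (by positivity) hdeg _
    rw [hcjb]
    calc 2 ^ j * (Real.pi ^ 8 / 4 * 2 ^ (j - 1) * (((klFlowDeg m : ℕ) : ℝ) + 1) ^ (j - 1) *
          ((curveExtC X G.S 1 + curveExtC X Q.S' 1 * |U|) * U ^ 2 * (4 : ℝ) ^ ((((1 : ℕ) : ℤ) - 2) * m)))
        ≤ 2 ^ j * (Real.pi ^ 8 / 4 * 2 ^ (j - 1) * ((2 : ℝ) ^ 8 * (4 : ℝ) ^ m) ^ (j - 1) *
          ((curveExtC X G.S 1 + curveExtC X Q.S' 1 * |U|) * U ^ 2 * (4 : ℝ) ^ ((((1 : ℕ) : ℤ) - 2) * m))) := by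
          have hz : 0 ≤ (4 : ℝ) ^ ((((1 : ℕ) : ℤ) - 2) * m) := zpow_nonneg (by norm_num) _
          have h1 := curveExtC_nonneg hX0 hGS 1
          have h2 := curveExtC_nonneg hX0 hQS 1
          gcongr
      _ = 2 ^ j * (Real.pi ^ 8 / 4 * 2 ^ (j - 1) * (2 : ℝ) ^ (8 * (j - 1))) *
          ((curveExtC X G.S 1 + curveExtC X Q.S' 1 * |U|) * U ^ 2) * (4 : ℝ) ^ (((j : ℤ) - 2) * m) := by
          rw [← four_pow_pred_mul_zpow hj1 m, mul_pow, ← pow_mul]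
          ring

/-- **THE FRAME-BAND JETS OF THE FLOW AT EVERY ORDER**: for `1 ≤ j`, `‖Dʲ e_{K_m}(q)‖ ≤ 4^j + Σ_{m′<m} A_j·4^{(j−2)m′}` (requires the history `m′ < m ≤ n+1`). -/
theorem frameLevel_flowFrame_jets_allOrders {G : GeoConsts} {Q : EngConsts} {R : RenConsts} (hGS : ∀ k, 0 ≤ G.S k) (hQS : ∀ k, 0 ≤ Q.S' k)
    {β U μ : ℝ} (hμ : μ ∈ klWindowC) {X : ℝ} (hX : ∀ l ≤ 4, ∀ x : ℝ, ‖iteratedFDeriv ℝ l salmhoferCutoff x‖ ≤ X)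
    {n : ℕ} (hP : ∀ m ≤ n, FlowPieceJetsAt L M β U μ R m) (hT : ∀ m ≤ n, TwoLegReadJetsF L M G Q β U μ m)
    {m : ℕ} (hmn : m ≤ n + 1) {j : ℕ} (hj : 1 ≤ j) (q : Momentum) :
    ‖iteratedFDeriv ℝ j (frameLevel μ (klFlowFrameU L M β U μ m)) q‖ ≤
      (4 : ℝ) ^ j + ∑ m' ∈ range m,
        (if j ≤ 4 then R.Gfr j * uPow j U
          else 2 ^ j * (Real.pi ^ 8 / 4 * 2 ^ (j - 1) * (2 : ℝ) ^ (8 * (j - 1))) *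
            ((curveExtC X G.S 1 + curveExtC X Q.S' 1 * |U|) * U ^ 2)) * (4 : ℝ) ^ (((j : ℤ) - 2) * m') := by
  have hfun : frameLevel μ (klFlowFrameU L M β U μ m) = fun q => frameLevel μ 0 q + (-1 : ℝ) • evalM (klFlowFrameU L M β U μ m) q := by
    funext q; rw [frameLevel_eq_zero_sub_evalM μ (klFlowFrameU L M β U μ m)]; simp; ring
  have hg : ContDiff ℝ j (fun q : Momentum => (-1 : ℝ) • evalM (klFlowFrameU L M β U μ m) q) := (contDiff_evalM _).const_smul _
  rw [hfun, fun_iteratedFDeriv_add_apply (EngineV8.contDiff_frameLevel μ 0).contDiffAt hg.contDiffAt,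
    iteratedFDeriv_const_smul_apply' (contDiff_evalM _).contDiffAt]
  refine (norm_add_le _ _).trans (add_le_add (norm_iteratedFDeriv_frameLevel_zero_le_pow μ hj q) ?_)
  rw [norm_smul, Real.norm_eq_abs, abs_neg, abs_one, one_mul]
  exact norm_iteratedFDeriv_evalM_klFlowFrameU_le_sum
    (pj := fun m' j => (if j ≤ 4 then R.Gfr j * uPow j U
          else 2 ^ j * (Real.pi ^ 8 / 4 * 2 ^ (j - 1) * (2 : ℝ) ^ (8 * (j - 1))) *
            ((curveExtC X G.S 1 + curveExtC X Q.S' 1 * |U|) * U ^ 2)) * (4 : ℝ) ^ (((j : ℤ) - 2) * m'))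
    (fun m' hm' q => flowPiece_jets_allOrders hGS hQS hμ hX hP hT m' (by omega) j q) q

end Summit.HubbardSuperconductivity.HubbardSuperconductivity.Theorems.EngineV8

end
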